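import Literature.MathematicalPhysics.QuantumLattice.SpinGaugedHubbardTorus

/-!
# `SgEndpoint` (stmt-HubbardSuperconductivity-16272), negative side: the flat link sector of
# `H_g` is DECOUPLED — no term of `H_g` (in particular not the electric term) connects two
# distinct flat link configurations, at any coupling

Crux-attack finding (refuter, route `ColourTheSpin`). The item's informal mechanism says that as
`g → 0⁺` "the electric term `g² Σ_b E_b` selects the gauge-averaged zero-twist class". In the
Lean object it cannot: a one-link operator `E_b` has nonzero entries only between configurations
agreeing off the bond `b` (`SpinGauged.electricLink_apply`), and two FLAT configurations (every
plaquette holonomy trivial) that agree off one bond are equal, because that bond sits in a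
plaquette whose other three links agree and whose holonomy is `1` on both sides (group
cancellation; `L ≥ 2` so that the four bonds of a plaquette are distinct). Since the hopping, the
Hubbard term and the magnetic term are diagonal in the link configuration, the whole Hamiltonian
`spinGaugedHubbardTorusWith ρ L U gE gB` has ZERO matrix entries between `(s, k)` and `(s', k')`
for distinct flat `k ≠ k'` — at every `gE`, `gB`, for every finite gauge group `G` and every
representation `ρ`. Consequently, within the flat sector the only `k`-dependence of the energy is
the fermion block energy `e₀(k)` (which of the 22 flat `Q₈` classes wins is decided by the
electrons, i.e. by spin-twist energetics — stub S2 of `Lines/birth.lean` — and not by the gauge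
kinetic term), and the selection of a gauge-averaged combination inside a class is invisible at
first order in `g²`. Helper for the disproof analysis; asserts no route item.
-/

namespace Summit.HubbardSuperconductivity.SgEndpointNegative

open Matrix Literature.MathematicalPhysics.QuantumLattice
  Literature.MathematicalPhysics.QuantumLattice.SpinGauged GaugedHubbard
open scoped Kronecker

variable {G : Type*} [Group G] (L : ℕ) [NeZero L]

/-- **Flat configurations agreeing off one bond are equal on that bond** (`L ≥ 2`): the bond lies
in the plaquette based at its own base point, whose other three links agree and whose holonomy is
trivial for both configurations. [folklore] -/
theorem apply_eq_of_flat_of_agree_off (hL : 2 ≤ L) {k k' : Bond L → G}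
    (hk : ∀ x, holonomy L k x = 1) (hk' : ∀ x, holonomy L k' x = 1) (b : Bond L)
    (hagree : ∀ b', b' ≠ b → k' b' = k b') : k' b = k b := by
  obtain ⟨x, i⟩ := b
  have hx := hk x
  have hx' := hk' x
  unfold holonomy at hx hx'
  have hs0 : x.shift 0 ≠ x := fun h => (FermionTorus.adj_shift hL x 0).ne h.symm
  have hs1 : x.shift 1 ≠ x := fun h => (FermionTorus.adj_shift hL x 1).ne h.symm
  fin_cases i
  · -- `b = (x, 0)` is the first link of the plaquette at `x`
    have e1 : k' (x.shift 0, 1) = k (x.shift 0, 1) := hagree _ (by simp)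
    have e2 : k' (x.shift 1, 0) = k (x.shift 1, 0) :=
      hagree _ (fun h => hs1 (Prod.ext_iff.1 h).1)
    have e3 : k' (x, 1) = k (x, 1) := hagree _ (by simp)
    rw [e1, e2, e3] at hx'
    have h := hx'.trans hx.symm
    simp only [mul_assoc] at h
    simpa using mul_right_cancel h
  · -- `b = (x, 1)` is the last (inverted) link of the plaquette at `x`
    have e1 : k' (x, 0) = k (x, 0) := hagree _ (by simp)
    have e2 : k' (x.shift 0, 1) = k (x.shift 0, 1) :=
      hagree _ (fun h => hs0 (Prod.ext_iff.1 h).1)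
    have e3 : k' (x.shift 1, 0) = k (x.shift 1, 0) := hagree _ (by simp)
    rw [e1, e2, e3] at hx'
    have h := hx'.trans hx.symm
    simpa using inv_injective (mul_left_cancel h)

/-- **Two distinct flat configurations never agree off a single bond** (`L ≥ 2`). [folklore] -/
theorem ne_update_of_flat_of_ne (hL : 2 ≤ L) {k k' : Bond L → G}
    (hk : ∀ x, holonomy L k x = 1) (hk' : ∀ x, holonomy L k' x = 1) (hne : k ≠ k') (b : Bond L) :
    k' ≠ Function.update k b (k' b) := by
  intro h
  have hagree := (eq_update_iff L b k k').1 h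
  have hb := apply_eq_of_flat_of_agree_off L hL hk hk' b hagree
  refine hne (funext fun b' => ?_)
  by_cases hb' : b' = b
  · rw [hb', hb]
  · exact (hagree b' hb').symm

variable [Fintype G] [DecidableEq G]

/-- **The one-link electric operator has no entries between distinct flat configurations.**
[folklore] -/
theorem electricLink_apply_eq_zero_of_flat (hL : 2 ≤ L) {k k' : Bond L → G}
    (hk : ∀ x, holonomy L k x = 1) (hk' : ∀ x, holonomy L k' x = 1) (hne : k ≠ k') (b : Bond L) :
    electricLink L b k k' = 0 := by
  rw [electricLink_apply, if_neg (ne_update_of_flat_of_ne L hL hk hk' hne b)]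

/-- **The electric energy `Σ_b E_b` has no entries between distinct flat configurations**: on the
flat sector it is the constant `|Bond L| (1 - |G|⁻¹)` (`SpinGauged.electric_apply_self`) and selects
nothing. [folklore] -/
theorem electric_apply_eq_zero_of_flat (hL : 2 ≤ L) {k k' : Bond L → G}
    (hk : ∀ x, holonomy L k x = 1) (hk' : ∀ x, holonomy L k' x = 1) (hne : k ≠ k') :
    SpinGauged.electric L k k' = 0 := by
  rw [SpinGauged.electric, Matrix.sum_apply]
  exact Finset.sum_eq_zero fun b _ => electricLink_apply_eq_zero_of_flat L hL hk hk' hne b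

/-- **The flat sector of the spin-gauged Hubbard torus is decoupled**: for distinct flat link
configurations `k ≠ k'` every matrix entry `⟨s, k| H |s', k'⟩` of
`spinGaugedHubbardTorusWith ρ L U gE gB` vanishes, for all couplings (`L ≥ 2`). In particular the
`g → 0⁺` selection among the flat `Q₈` classes in `SgEndpoint`'s mechanism is made by the fermion
block energies alone, not by the electric term. [folklore] -/
theorem spinGaugedHubbardTorusWith_apply_eq_zero_of_flat (ρ : G →* Matrix (Fin 2) (Fin 2) ℂ)
    (hL : 2 ≤ L) (U gE gB : ℝ) {k k' : Bond L → G}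
    (hk : ∀ x, holonomy L k x = 1) (hk' : ∀ x, holonomy L k' x = 1) (hne : k ≠ k')
    (s s' : Finset (Orb (FermionTorus 2 L))) :
    spinGaugedHubbardTorusWith ρ L U gE gB (s, k) (s', k') = 0 := by
  have hE := electric_apply_eq_zero_of_flat L hL hk hk' hne
  have hhop : hop ρ L (s, k) (s', k') = 0 := by
    simp [hop, Matrix.sum_apply, kroneckerMap_apply, diagonal_apply_ne _ hne]
  have hhop' : hop ρ L (s', k') (s, k) = 0 := by
    simp [hop, Matrix.sum_apply, kroneckerMap_apply, diagonal_apply_ne _ (Ne.symm hne)]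
  have hM : SpinGauged.magnetic ρ L k k' = 0 := by
    rw [SpinGauged.magnetic, diagonal_apply_ne _ hne]
  simp [spinGaugedHubbardTorusWith, Matrix.add_apply, Matrix.neg_apply, Matrix.smul_apply,
    conjTranspose_apply, kroneckerMap_apply, hhop, hhop', hE, hM, Matrix.one_apply_ne hne]

/-- The `Q₈` specialisation used by route ColourTheSpin: `H_g(L,U)` does not couple distinct flat
`Q₈` link configurations, at any `g`. [folklore] -/
theorem spinGaugedHubbardTorus_apply_eq_zero_of_flat (hL : 2 ≤ L) (U g : ℝ) {k k' : Bond L → Q8}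
    (hk : ∀ x, holonomy L k x = 1) (hk' : ∀ x, holonomy L k' x = 1) (hne : k ≠ k')
    (s s' : Finset (Orb (FermionTorus 2 L))) :
    spinGaugedHubbardTorus L U g (s, k) (s', k') = 0 :=
  spinGaugedHubbardTorusWith_apply_eq_zero_of_flat L Q8.rep hL U _ _ hk hk' hne s s'

end Summit.HubbardSuperconductivity.SgEndpointNegative
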